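import Summits.QuantumFields.BalabanUV.Beta.EriceRemainderEnclosureHistoryAutonomyComparisonAgeCompositionAdaptiveFourAges

/-!
# EriceRemainderEnclosureHistoryAutonomyComparisonAgeCompositionAdaptiveFourAgesEvery — (E101f) route (N), first order: THE CENSUS FOUR AGES FOR EVERY
# YOUNG SECOND AGE.  (E101e) closes `{1,k₂,k₃,k₄}` at every top ratio for `2 ≤ k₂ ≤ 29` (the young pair `{1,k₂}` as the youngest level, cap `0.8333`).
# For `k₂ ≥ 30` the young pair cap is untyped, but none is needed: take FOUR adaptive levels `{1}`, `{k₂}`, `{k₃}`, `{k₄}` with overshoots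
# `κ₀ = 207∕500` (the young age's cap `0.7072·(1 + 207∕500) ≤ 1`), `κ₁ = 1∕5`, `κ₂ = 4k₃X₃∕(k₄(1 − X₃))`, `κ₃ = 0`.  The top closure is equality, the
# third is EXACTLY (E101d)'s middle closure with `(x_{k₃}, x_{k₄})` and `κ₁ = 1∕5` in the role of `κ₀`, and the new second closure
# `4X₁(6∕5) + 1∕5 ≤ (207∕500)(1 − (6∕5)X₁)·k₂` holds for `X₁ = x_{k₂} ≤ 0.616` ((E94b) from `k₂ ≥ 29`) and `k₂ ≥ 30` (`3.157 ≤ 3.239`):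
# **`flow_nonneg_census_four_ages_adaptive_far`** (`k₂ ≥ 30`, `61k₂ ≤ k₃`, `2k₃ < k₄`).  With (E99f) `flow_nonneg_census_four_ages_near_old_pair_every`
# (`k₄ ≤ 2k₃`, every `k₂`) and (E101e) `flow_nonneg_census_four_ages_all` (`k₂ ≤ 29`): **`flow_nonneg_census_four_ages_every`** — the census four ages
# hold along every admissible flow for EVERY `k₂ ≥ 2`, `k₃ ≥ 61k₂` and EVERY `k₄ > k₃`.

Cell `pub-balaban`, β-function sub-cell, BINDER row D4 «RemainderConst leaves for Bałaban's split» (`HOME/BINDER-OWNERS.md`; owner lineage `b2b-balaban-beta-an4`;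
this file by co-owner #2 lineage `b2b-balaban-beta-d4-p2`, generation 88), β-FLOW TEAM duty (1), FREEZE (0) honoured (def-free; nothing restated).

HONEST FRAMING (page 1, verbatim and binding).  *"Discharging BetaPertH makes Bałaban's UV stability UNCONDITIONAL — a real constructive-QFT result; it is
NOT the continuum limit and NOT the Clay problem."*  THIS FILE DISCHARGES NOTHING OF THE KIND.  Elementary real algebra ∕ real analysis about ABSTRACT
functionals on a box ]0,γ]^ℕ with displayed floors, profiles and signs, and the FIRST-ORDER renewal objects of route (N) built from them — hypotheses of a
census, not facts; the form, signs, ages and moments of Bałaban's (1.22) limit functional are NOT PRINTED ([I] p. 298; GAPS G-t4-U2-1∕-2) and NOT asserted.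
Row D4 class UNCHANGED (critical-path width 0; instance 0∕1; D4 DISCHARGE NO DATE).  HONEST DEPENDENCY: continuum YM on T⁴ ⇐ BetaPertH ∧ nine spine
estimates (0/9 proved); BetaPertH ⇐ (D1) ∧ (D4) ∧ CAP+tail; G-an2-4 gates asym, D1 and NE2/3/4.

THE POINT (README `HOME/b2b-balaban-beta-d4-p2/g88/README.md` §5).  Uses (E101b) `flow_nonneg_adaptive_cluster_levels`, (E101d) `middle_closure_bracket*`, (E100g)
`old_block_load_le_span3`, (E100e) `old_block_load_le_span4`, (E101c) `old_block_load_le_span8∕16∕32`, (E94b) `load_le_of_sq`, (E99f)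
`flow_nonneg_census_four_ages_near_old_pair_every`, (E101e) `flow_nonneg_census_four_ages_all` BY NAME.  NOT CLAIMED: `k₃ < 61k₂`; five or more ages;
anything printed — NOT B12 Thm 2, NOT BetaPertH, NOT continuum, NOT Clay.

WHAT IS PROVED ([folklore]; 0 `def`, 0 sorry).  §1 **`flow_nonneg_census_four_ages_adaptive_far`**.  §2 **`flow_nonneg_census_four_ages_every`**.
-/
noncomputable section
open Finset

namespace Summit.QuantumFields.BalabanUV.Beta.EriceRemainderEnclosureHistoryAutonomyComparisonAgeCompositionAdaptiveFourAgesEvery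

open Literature.MathematicalPhysics.QuantumFieldTheory.Balaban1983to89
open Literature.MathematicalPhysics.QuantumFieldTheory.Balaban1983to89.T4BetaStationary
open Literature.MathematicalPhysics.QuantumFieldTheory.Balaban1983to89.T4BetaFlowWellPosed
open Summit.QuantumFields.BalabanUV.Beta.EriceRemainderEnclosureHistoryAutonomyComparisonAgeCompositionYoungPairMoment (load_le_of_sq)
open Summit.QuantumFields.BalabanUV.Beta.EriceRemainderEnclosureHistoryAutonomyComparisonAgeCompositionAdaptiveLevels (flow_nonneg_adaptive_cluster_levels)
open Summit.QuantumFields.BalabanUV.Beta.EriceRemainderEnclosureHistoryAutonomyComparisonAgeCompositionOldBlockCapSpan3 (old_block_load_le_span3)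
open Summit.QuantumFields.BalabanUV.Beta.EriceRemainderEnclosureHistoryAutonomyComparisonAgeCompositionOldBlockCapWide (old_block_load_le_span4)
open Summit.QuantumFields.BalabanUV.Beta.EriceRemainderEnclosureHistoryAutonomyComparisonAgeCompositionOldBlockCapWider
  (old_block_load_le_span8 old_block_load_le_span16 old_block_load_le_span32)
open Summit.QuantumFields.BalabanUV.Beta.EriceRemainderEnclosureHistoryAutonomyComparisonAgeCompositionNearPairSeparatedAgesEvery
  (flow_nonneg_census_four_ages_near_old_pair_every)
open Summit.QuantumFields.BalabanUV.Beta.EriceRemainderEnclosureHistoryAutonomyComparisonAgeCompositionAdaptiveFourAgesBoxes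
open Summit.QuantumFields.BalabanUV.Beta.EriceRemainderEnclosureHistoryAutonomyComparisonAgeCompositionAdaptiveFourAges (flow_nonneg_census_four_ages_all)

variable {B : (ℕ → ℝ) → ℝ} {γ b gIR : ℝ} {L : ℕ → ℝ} {K : ℕ} {h g : ℕ → ℝ}

/-! ## §1 Four adaptive levels: `{1}`, `{k₂}`, `{k₃}`, `{k₄}` for `k₂ ≥ 30` -/

/-- **THE CENSUS FOUR AGES `{1, k₂, k₃, k₄}`, `k₂ ≥ 30`, `61k₂ ≤ k₃`, `2k₃ < k₄`.**  `0 ≤ ε ≤ e` at every pin, every horizon, every damping of the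
self-consistent class — (E101b) with the four single levels and `κ = (207∕500, 1∕5, 4k₃x_{k₄}∕(k₄(1 − x_{k₄})), 0)`: closures `0.7072·1.414 ≤ 1` (young age,
(E94b)), `4x_{k₂}(6∕5) + 1∕5 ≤ (207∕500)(1 − (6∕5)x_{k₂})k₂` (`x_{k₂} ≤ 0.616` from `k₂ ≥ 29`, `k₂ ≥ 30`), the middle closure of (E101d) for `(x_{k₃}, x_{k₄})`
on the bracket of `k₄∕k₃`, the top with equality. [folklore] -/
theorem flow_nonneg_census_four_ages_adaptive_far
    (hmono : ∀ u v : ℕ → ℝ, SeqBox γ u → SeqBox γ v → (∀ j, u j ≤ v j) → B u ≤ B v)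
    (hL : ∀ k, 0 ≤ L k) (hb : 0 < b) (hlo : ∀ u, SeqBox γ u → b ≤ B u) (hdom : ∀ u, SeqBox γ u → ∑ k ∈ range K, L k * u k ≤ B u)
    (hh : SeqBox γ h) (hf : MemFlow B gIR h) (hg : ∀ t, 0 < g t ∧ g t ≤ 1)
    (hgF : ∀ t, 1 ≤ g t * (1 + ∑ k ∈ range K, L k * h (t + k) ^ 3 / 2))
    {k₂ k₃ k₄ : ℕ} (hk2 : 30 ≤ k₂) (hk3 : 61 * k₂ ≤ k₃) (hk34 : 2 * k₃ < k₄) (hk4K : k₄ < K)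
    (hLa : ∀ l, l < K → l ≠ 1 → l ≠ k₂ → l ≠ k₃ → l ≠ k₄ → L l = 0)
    {N : ℕ} {KL : ℕ → ℕ → ℕ → ℝ}
    (hKL : ∀ k n l, KL k n l = if 0 < k ∧ k < K ∧ l < k then L k * h (n + k) ^ 3 / 2 * ∏ t ∈ Ico (n + 1 + l) (n + k + 1), g t else 0)
    {KA : ℕ → ℕ → ℕ → ℝ} {RA : ℕ → (ℕ → ℝ) → ℕ → ℝ}
    (hRA : ∀ i v m, RA i v m = ∑ l ∈ range K, KA i m l * v (m + 1 + l))
    (hKA : ∀ i m l, KA i m l = KL i m l + KA (i + 1) m l) (hKAtop : ∀ m l, KA K m l = 0)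
    {e ε : ℕ → ℝ} (he0 : ∀ m, 0 ≤ e m) (hea : ∀ m, e (m + 1) ≤ e m)
    (hεt : ∀ m, N < m → ε m = 0) (hεrec : ∀ m, ε m = e m - RA 1 ε m) : ∀ m, 0 ≤ ε m ∧ ε m ≤ e m := by
  have hpos : ∀ n, 0 < h n := fun n => (hh n).1
  have hk3pos : (0 : ℝ) < k₃ := by exact_mod_cast (show 0 < k₃ by omega)
  have hk4pos : (0 : ℝ) < k₄ := by exact_mod_cast (show 0 < k₄ by omega)
  have hρ : (61 : ℝ) * k₂ ≤ k₃ := by exact_mod_cast hk3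
  have hk2r : (30 : ℝ) ≤ k₂ := by exact_mod_cast hk2
  -- the four loads and their single caps (E94b)
  obtain ⟨X₀, hX₀⟩ : ∃ X₀ : ℕ → ℝ, ∀ q, X₀ q = L 1 * h (q + 1) ^ 3 / 2 := ⟨_, fun _ => rfl⟩
  obtain ⟨X₁, hX₁⟩ : ∃ X₁ : ℕ → ℝ, ∀ q, X₁ q = (k₂ : ℝ) * (L k₂ * h (q + k₂) ^ 3 / 2) := ⟨_, fun _ => rfl⟩
  obtain ⟨X₂, hX₂⟩ : ∃ X₂ : ℕ → ℝ, ∀ q, X₂ q = (k₃ : ℝ) * (L k₃ * h (q + k₃) ^ 3 / 2) := ⟨_, fun _ => rfl⟩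
  obtain ⟨X₃, hX₃⟩ : ∃ X₃ : ℕ → ℝ, ∀ q, X₃ q = (k₄ : ℝ) * (L k₄ * h (q + k₄) ^ 3 / 2) := ⟨_, fun _ => rfl⟩
  have hX0c : ∀ q, X₀ q ≤ 7072 / 10000 := fun q => by
    rw [hX₀]
    have := load_le_of_sq hmono hL hb hlo hdom hh hf (k := 1) le_rfl (by omega) (so := 7072 / 10000) (by norm_num) (by norm_num) q
    simpa using this
  have hX1c : ∀ q, 0 ≤ X₁ q ∧ X₁ q ≤ 77 / 125 := fun q => by
    refine ⟨by rw [hX₁]; have := hL k₂; have := hpos (q + k₂); positivity, ?_⟩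
    rw [hX₁]; exact load_le_of_sq hmono hL hb hlo hdom hh hf (by omega) (by omega) (so := 77 / 125) (by norm_num) (by nlinarith) q
  have hX2c : ∀ q, 0 ≤ X₂ q ∧ X₂ q ≤ 3071 / 5000 := fun q => by
    refine ⟨by rw [hX₂]; have := hL k₃; have := hpos (q + k₃); positivity, ?_⟩
    rw [hX₂]
    have hr : (56 : ℝ) ≤ k₃ := by exact_mod_cast (show 56 ≤ k₃ by omega)
    exact load_le_of_sq hmono hL hb hlo hdom hh hf (by omega) (by omega) (so := 3071 / 5000) (by norm_num) (by nlinarith) q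
  have hX3c : ∀ q, 0 ≤ X₃ q ∧ X₃ q ≤ 3071 / 5000 := fun q => by
    refine ⟨by rw [hX₃]; have := hL k₄; have := hpos (q + k₄); positivity, ?_⟩
    rw [hX₃]
    have hr : (56 : ℝ) ≤ k₄ := by exact_mod_cast (show 56 ≤ k₄ by omega)
    exact load_le_of_sq hmono hL hb hlo hdom hh hf (by omega) hk4K (so := 3071 / 5000) (by norm_num) (by nlinarith) q
  -- the levels and the overshoots
  obtain ⟨S, hS⟩ : ∃ S : ℕ → Finset ℕ, ∀ j, S j = if j = 0 then {1} else if j = 1 then {k₂} else if j = 2 then {k₃} else {k₄} := ⟨_, fun _ => rfl⟩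
  obtain ⟨LO, hLO⟩ : ∃ LO : ℕ → ℕ, ∀ j, LO j = if j = 0 then 1 else if j = 1 then k₂ else if j = 2 then k₃ else k₄ := ⟨_, fun _ => rfl⟩
  obtain ⟨κ, hκ⟩ : ∃ κ : ℕ → ℕ → ℝ, ∀ j q, κ j q =
      if j = 0 then 207 / 500 else if j = 1 then 1 / 5 else if j = 2 then 4 * k₃ * X₃ q / (k₄ * (1 - X₃ q)) else 0 := ⟨_, fun _ _ => rfl⟩
  have hS0 : S 0 = {1} := by rw [hS]; simp
  have hS1 : S 1 = {k₂} := by rw [hS]; simp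
  have hS2 : S 2 = {k₃} := by rw [hS]; simp
  have hS3 : S 3 = {k₄} := by rw [hS]; simp
  have hLO0 : LO 0 = 1 := by rw [hLO]; simp
  have hLO1 : LO 1 = k₂ := by rw [hLO]; simp
  have hLO2 : LO 2 = k₃ := by rw [hLO]; simp
  have hLO3 : LO 3 = k₄ := by rw [hLO]; simp
  have hκ0v : ∀ q, κ 0 q = 207 / 500 := fun q => by rw [hκ]; simp
  have hκ1v : ∀ q, κ 1 q = 1 / 5 := fun q => by rw [hκ]; simp
  have hκ2v : ∀ q, κ 2 q = 4 * k₃ * X₃ q / (k₄ * (1 - X₃ q)) := fun q => by rw [hκ]; simp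
  have hκ3v : ∀ q, κ 3 q = 0 := fun q => by rw [hκ]; simp
  have hden : ∀ q, 0 < (k₄ : ℝ) * (1 - X₃ q) := fun q => mul_pos hk4pos (by linarith [(hX3c q).2])
  have hκ2nn' : ∀ q, 0 ≤ κ 2 q := fun q => by
    rw [hκ2v]; exact div_nonneg (by have := (hX3c q).1; positivity) (hden q).le
  have hκeq : ∀ q, κ 2 q * ((k₄ : ℝ) * (1 - X₃ q)) = 4 * (k₃ : ℝ) * X₃ q := fun q => by
    rw [hκ2v, div_mul_cancel₀ _ (ne_of_gt (hden q))]
  -- members of S j for j < 4 are single ages; one helper for all the structural goals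
  have hmem : ∀ j, j < 4 → ∀ k ∈ S j, k = LO j := by
    intro j hj k hk
    interval_cases j
    · rw [hS0, mem_singleton] at hk; rw [hLO0]; exact hk
    · rw [hS1, mem_singleton] at hk; rw [hLO1]; exact hk
    · rw [hS2, mem_singleton] at hk; rw [hLO2]; exact hk
    · rw [hS3, mem_singleton] at hk; rw [hLO3]; exact hk
  have hLOv : ∀ j, j < 4 → 1 ≤ LO j ∧ LO j < K ∧ (j + 1 < 4 → LO j < LO (j + 1)) := by
    intro j hj
    interval_cases j
    · rw [hLO0, hLO1]; omega
    · rw [hLO1, hLO2]; omega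
    · rw [hLO2, hLO3]; omega
    · rw [hLO3]; omega
  refine flow_nonneg_adaptive_cluster_levels hmono hL hb hlo hdom hh hf hg hgF (by omega) (r := 4) (S := S) (lo := LO) (hi := LO) (κ := κ)
    (fun j q => ?_) (fun j hj k hk => ?_) (fun j hj k hk => ?_) (fun j hj k hk => ?_) (fun j hj1 hjr => le_rfl) (fun j hj1 hjr => (hLOv j hjr).1)
    (fun j hj => ?_) (fun i j hij hjr => ?_) (fun l hl hno => ?_) (fun q => ?_) (fun j q hj1 hjr => ?_) hKL hRA hKA hKAtop he0 hea hεt hεrec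
  · -- overshoots are non-negative
    rcases Nat.lt_or_ge j 4 with hj | hj
    · interval_cases j
      · rw [hκ0v]; norm_num
      · rw [hκ1v]; norm_num
      · exact hκ2nn' q
      · rw [hκ3v]
    · rw [hκ, if_neg (by omega), if_neg (by omega), if_neg (by omega)]
  · rw [hmem j hj k hk]; exact ⟨(hLOv j hj).1, (hLOv j hj).2.1⟩
  · rw [hmem j hj k hk]
  · rw [hmem j hj k hk]
  · exact ((hLOv j (by omega)).2.2 hj).le
  · -- pairwise disjoint: distinct single ages
    have hlt : LO i < LO j := by
      have h01 := (hLOv 0 (by omega)).2.2 (by omega)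
      have h12 := (hLOv 1 (by omega)).2.2 (by omega)
      have h23 := (hLOv 2 (by omega)).2.2 (by omega)
      have : (i = 0 ∧ j = 1) ∨ (i = 0 ∧ j = 2) ∨ (i = 0 ∧ j = 3) ∨ (i = 1 ∧ j = 2) ∨ (i = 1 ∧ j = 3) ∨ (i = 2 ∧ j = 3) := by omega
      rcases this with ⟨rfl, rfl⟩ | ⟨rfl, rfl⟩ | ⟨rfl, rfl⟩ | ⟨rfl, rfl⟩ | ⟨rfl, rfl⟩ | ⟨rfl, rfl⟩ <;> omega
    exact disjoint_left.mpr fun x hx hx' => by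
      have := hmem i (by omega) x hx; have := hmem j hjr x hx'; omega
  · -- the profile vanishes off the four ages
    have h0 := hno 0 (by omega); have h1 := hno 1 (by omega); have h2 := hno 2 (by omega); have h3 := hno 3 (by omega)
    rw [hS0, mem_singleton] at h0
    rw [hS1, mem_singleton] at h1
    rw [hS2, mem_singleton] at h2
    rw [hS3, mem_singleton] at h3
    exact hLa l hl h0 h1 h2 h3
  · -- the young age's closure: 0.7072·(1 + 207∕500) ≤ 1
    rw [hS0, hκ0v, sum_singleton, Nat.cast_one, one_mul]
    have := hX0c q; rw [hX₀] at this
    nlinarith [this]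
  · -- the three older levels
    have : j = 1 ∨ j = 2 ∨ j = 3 := by omega
    rcases this with rfl | rfl | rfl
    · -- {k₂}: 4X₁(6∕5) + 1∕5 ≤ (207∕500)(1 − (6∕5)X₁)·k₂ from X₁ ≤ 0.616, k₂ ≥ 30
      rw [hS1, sum_singleton, show (1 : ℕ) - 1 = 0 from rfl, hLO0, hLO1, hκ0v, hκ1v, ← hX₁, Nat.cast_one, one_mul]
      have h1c := hX1c q
      refine ⟨by nlinarith [h1c.2], ?_⟩
      have hp := mul_le_mul hk2r (show (163 : ℝ) / 625 ≤ 1 - X₁ q * (1 + 1 / 5) by linarith [h1c.2]) (by norm_num) (Nat.cast_nonneg k₂)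
      linarith [hp, h1c.1, h1c.2]
    · -- {k₃}: THE MIDDLE CLOSURE of (E101d), with κ₁ = 1∕5 in the role of κ₀
      rw [hS2, sum_singleton, show (2 : ℕ) - 1 = 1 from rfl, hLO1, hLO2, hκ1v, ← hX₂]
      have h2c := hX2c q
      have h3c := hX3c q
      rcases le_or_gt k₄ (3 * k₃) with hbr0 | hbr0
      · have hj : X₂ q + X₃ q ≤ 13 / 20 := by
          have := old_block_load_le_span3 hmono hL hb hlo hdom hh hf (S := {k₃, k₄}) (lo := k₃) (hi := k₄) (by omega) (by omega) hk4K
            (fun k hk => by simp only [mem_insert, mem_singleton] at hk; rcases hk with rfl | rfl <;> omega) q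
          rwa [sum_pair (show k₃ ≠ k₄ by omega), ← hX₂, ← hX₃] at this
        exact middle_closure_bracket3 h2c.1 h2c.2 h3c.2 hj (by exact_mod_cast (show 2 * k₃ ≤ k₄ by omega)) hρ hk3pos (hκ2nn' q) (hκeq q)
      rcases le_or_gt k₄ (4 * k₃) with hbr1 | hbr1
      · have hj : X₂ q + X₃ q ≤ 11 / 16 := by
          have := old_block_load_le_span4 hmono hL hb hlo hdom hh hf (S := {k₃, k₄}) (lo := k₃) (hi := k₄) (by omega) (by omega) hk4K
            (fun k hk => by simp only [mem_insert, mem_singleton] at hk; rcases hk with rfl | rfl <;> omega) q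
          rwa [sum_pair (show k₃ ≠ k₄ by omega), ← hX₂, ← hX₃] at this
        exact middle_closure_bracket4 h2c.1 h2c.2 h3c.2 hj (by exact_mod_cast (show 3 * k₃ ≤ k₄ by omega)) hρ hk3pos (hκ2nn' q) (hκeq q)
      rcases le_or_gt k₄ (8 * k₃) with hbr2 | hbr2
      · have hj : X₂ q + X₃ q ≤ 77 / 100 := by
          have := old_block_load_le_span8 hmono hL hb hlo hdom hh hf (S := {k₃, k₄}) (lo := k₃) (hi := k₄) (by omega) (by omega) hk4K
            (fun k hk => by simp only [mem_insert, mem_singleton] at hk; rcases hk with rfl | rfl <;> omega) q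
          rwa [sum_pair (show k₃ ≠ k₄ by omega), ← hX₂, ← hX₃] at this
        exact middle_closure_bracket8 h2c.1 h2c.2 h3c.2 hj (by exact_mod_cast (show 4 * k₃ ≤ k₄ by omega)) hρ hk3pos (hκ2nn' q) (hκeq q)
      rcases le_or_gt k₄ (16 * k₃) with hbr3 | hbr3
      · have hj : X₂ q + X₃ q ≤ 89 / 100 := by
          have := old_block_load_le_span16 hmono hL hb hlo hdom hh hf (S := {k₃, k₄}) (lo := k₃) (hi := k₄) (by omega) (by omega) hk4K
            (fun k hk => by simp only [mem_insert, mem_singleton] at hk; rcases hk with rfl | rfl <;> omega) q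
          rwa [sum_pair (show k₃ ≠ k₄ by omega), ← hX₂, ← hX₃] at this
        exact middle_closure_bracket16 h2c.1 h2c.2 h3c.2 hj (by exact_mod_cast (show 8 * k₃ ≤ k₄ by omega)) hρ hk3pos (hκ2nn' q) (hκeq q)
      rcases le_or_gt k₄ (32 * k₃) with hbr4 | hbr4
      · have hj : X₂ q + X₃ q ≤ 21 / 20 := by
          have := old_block_load_le_span32 hmono hL hb hlo hdom hh hf (S := {k₃, k₄}) (lo := k₃) (hi := k₄) (by omega) (by omega) hk4K
            (fun k hk => by simp only [mem_insert, mem_singleton] at hk; rcases hk with rfl | rfl <;> omega) q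
          rwa [sum_pair (show k₃ ≠ k₄ by omega), ← hX₂, ← hX₃] at this
        exact middle_closure_bracket32 h2c.1 h2c.2 h3c.2 hj (by exact_mod_cast (show 16 * k₃ ≤ k₄ by omega)) hρ hk3pos (hκ2nn' q) (hκeq q)
      exact middle_closure_bracketTop h2c.1 h2c.2 h3c.2 (by exact_mod_cast (show 32 * k₃ ≤ k₄ by omega)) hρ hk3pos (hκ2nn' q) (hκeq q)
    · -- {k₄}: the top closure, equality by the choice of κ₂
      rw [hS3, sum_singleton, show (3 : ℕ) - 1 = 2 from rfl, hLO2, hLO3, hκ3v, ← hX₃]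
      refine ⟨by linarith [(hX3c q).2], ?_⟩
      have e1 : κ 2 q * (1 - X₃ q * (1 + 0)) * (k₄ : ℝ) = κ 2 q * ((k₄ : ℝ) * (1 - X₃ q)) := by ring
      rw [e1, hκeq q]
      apply le_of_eq; ring

/-! ## §2 Every young second age, every top ratio -/

/-- **THE CENSUS FOUR AGES `{1, k₂, k₃, k₄}` FOR EVERY `k₂ ≥ 2`, `k₃ ≥ 61k₂` AND EVERY `k₄ > k₃`.**  `0 ≤ ε ≤ e` at every pin, every horizon, every
damping of the self-consistent class: `k₂ ≤ 29` by (E101e) `flow_nonneg_census_four_ages_all`; `k₂ ≥ 30` and `k₄ ≤ 2k₃` by (E99f)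
`flow_nonneg_census_four_ages_near_old_pair_every`; `k₂ ≥ 30` and `k₄ > 2k₃` by `flow_nonneg_census_four_ages_adaptive_far`. [folklore] -/
theorem flow_nonneg_census_four_ages_every
    (hmono : ∀ u v : ℕ → ℝ, SeqBox γ u → SeqBox γ v → (∀ j, u j ≤ v j) → B u ≤ B v)
    (hL : ∀ k, 0 ≤ L k) (hb : 0 < b) (hlo : ∀ u, SeqBox γ u → b ≤ B u) (hdom : ∀ u, SeqBox γ u → ∑ k ∈ range K, L k * u k ≤ B u)
    (hh : SeqBox γ h) (hf : MemFlow B gIR h) (hg : ∀ t, 0 < g t ∧ g t ≤ 1)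
    (hgF : ∀ t, 1 ≤ g t * (1 + ∑ k ∈ range K, L k * h (t + k) ^ 3 / 2))
    {k₂ k₃ k₄ : ℕ} (hk2 : 2 ≤ k₂) (hk3 : 61 * k₂ ≤ k₃) (hk34 : k₃ < k₄) (hk4K : k₄ < K)
    (hLa : ∀ l, l < K → l ≠ 1 → l ≠ k₂ → l ≠ k₃ → l ≠ k₄ → L l = 0)
    {N : ℕ} {KL : ℕ → ℕ → ℕ → ℝ}
    (hKL : ∀ k n l, KL k n l = if 0 < k ∧ k < K ∧ l < k then L k * h (n + k) ^ 3 / 2 * ∏ t ∈ Ico (n + 1 + l) (n + k + 1), g t else 0)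
    {KA : ℕ → ℕ → ℕ → ℝ} {RA : ℕ → (ℕ → ℝ) → ℕ → ℝ}
    (hRA : ∀ i v m, RA i v m = ∑ l ∈ range K, KA i m l * v (m + 1 + l))
    (hKA : ∀ i m l, KA i m l = KL i m l + KA (i + 1) m l) (hKAtop : ∀ m l, KA K m l = 0)
    {e ε : ℕ → ℝ} (he0 : ∀ m, 0 ≤ e m) (hea : ∀ m, e (m + 1) ≤ e m)
    (hεt : ∀ m, N < m → ε m = 0) (hεrec : ∀ m, ε m = e m - RA 1 ε m) : ∀ m, 0 ≤ ε m ∧ ε m ≤ e m := by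
  rcases le_or_gt k₂ 29 with hk29 | hk30
  · exact flow_nonneg_census_four_ages_all hmono hL hb hlo hdom hh hf hg hgF hk2 hk29 hk3 hk34 hk4K hLa hKL hRA hKA hKAtop he0 hea hεt hεrec
  rcases le_or_gt k₄ (2 * k₃) with hnear | hfar
  · exact flow_nonneg_census_four_ages_near_old_pair_every hmono hL hb hlo hdom hh hf hg hgF hk2 hk3 hk34 hnear hk4K hLa hKL hRA hKA hKAtop
      he0 hea hεt hεrec
  · exact flow_nonneg_census_four_ages_adaptive_far hmono hL hb hlo hdom hh hf hg hgF (by omega) hk3 hfar hk4K hLa hKL hRA hKA hKAtop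
      he0 hea hεt hεrec

end Summit.QuantumFields.BalabanUV.Beta.EriceRemainderEnclosureHistoryAutonomyComparisonAgeCompositionAdaptiveFourAgesEvery
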